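import Summits.Langlands.Langlands.Theses.EisensteinGelfandKirillov
import Literature.NumberTheory.Automorphic.CompletedCohomologyGLHecke
import Summits.Langlands.Langlands.Theorems.EisensteinGelfandKirillovCrystallineProModularClassicalAbsolutelyIrreducibleOfOdd

/-!
# Line `Sketch` for the crux `EisensteinGelfandKirillov.CrystallineProModularClassical`
(stmt-Langlands-18274, THE EXIT of route EisensteinGelfandKirillov) — LEAD'S SKELETON, rev 5
(rev 1–4: prover-line-stmt-Langlands-18274-0; rev 5: continuation lead prover-line-stmt-Langlands-18274-c1-0; lineage 0, gen 1, 2026-08-17).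

Source line: crux-ideate round 1 ideator 2, evidence `20260817T043329Z-Sketch.lean` (0 sorries: three case
Props + the pure-logic reassembly `crux_of_cases`), cards `Ideas/partial-fontaine-operators.md` (parallel case =
port of Jiang, *Classicality for Hilbert modular forms*, arXiv:2605.18426 Thm 1.1.1) and
`Ideas/conjugate-curve-ladder.md` (odd degree; even degree via quaternionic surfaces).  The evidence file itself
is not mounted in a prover jail; this file RE-TYPES the same composition with registered `stub_*` sorries.

**Composition idea (unchanged from the Sketch).**  Case split on the labelled Hodge–Tate weights of `ρ` at the
places above `p` (PARALLEL: one multiset `S` for every `v ∣ p` and every label `τ : F_v →+* ℚ̄_p`, versus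
NON-PARALLEL) and, in the non-parallel case, on the parity of `d = [F:ℚ]` (the conjugate-curve ladder runs on
Shimura CURVES for odd `d`, on quaternionic SURFACES for even `d`).  Pure logic:
`CrystallineProModularClassical_of : stub_absolutelyIrreducible_of_odd → stub_parallel →
stub_oddDegree_nonParallel → stub_evenDegree_nonParallel → CrystallineProModularClassical`
(`Classical.em` on parallelness, `Nat.even_or_odd d`).

**Rev 5 (lead c1, 2026-08-17T06:2xZ) — OCCUPANCY RETYPED TORSION-TOLERANTLY; LINE VERDICT: DEAD (see `Lines/Sketch.dead.md`).**
The eigenvector clause of `stub_occupancy` (conclusion) and of `stub_parallel_of_occupancy` (hypothesis) now reads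
`∀ w ∉ bad, ∀ i, ∃ N, p^N • (T_{w,i} c − a_{w,i} • c) = 0` instead of the EXACT `T_{w,i} c = a_{w,i} • c`: the module
`H̃^j_O = lim_t colim_r H^j(X_{U_r}, O/p^t)` (`TameLevel.completedCohomology`) may carry `p`-power torsion (integral torsion classes
surviving the colimit), while the hypothesis every source consumes (Pan II Thm 1.1.2 (1), Jiang Thm 1.1.1 (1): `H̃(K^p, E)[χ] ≠ 0`) is an
eigenvector in the Banach space `H̃_O ⊗_O E`, i.e. a non-torsion `c ∈ H̃_O` with `T c − a c` TORSION for each operator — rev 4's exact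
form was (slightly) stronger than the printed hypothesis and than what any engine-side flatness argument outputs.  `c` non-torsion is
kept as `∀ m, p^m • c ≠ 0`.  Composition unchanged.  The line's verdict does not depend on this repair: all four stubs remain open in print
(K0 at Eisenstein 𝔪; non-parallel Fontaine operators; the parallel port unstatable without a definition item for the completed cohomology
of the Hilbert modular VARIETY) — `Lines/Sketch.dead.md`.

**Rev 4.** `stub_absolutelyIrreducible_of_odd` LANDED (wave 1, p143332) and is imported: 4 open stubs remain — `stub_occupancy` (OPEN CORE K0),
`stub_parallel_of_occupancy` (port), `stub_oddDegree_nonParallel`, `stub_evenDegree_nonParallel` (open in print).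

**Rev 3 (wave-1 `stub-misstated` repair, worker on `stub_oddDegree_nonParallel`).** The PARALLELNESS clause now quantifies the
labels `τ` over `ℚ_p`-ALGEBRA homomorphisms `F_v →ₐ[ℚ_p] ℚ̄_p` (as the HT-regularity clause does), no longer over all ring homomorphisms
`F_v →+* ℚ̄_p`: the worker PROVED (work/stubs/stub_oddDegree_nonParallel_scratch_wildLabels.lean, `typedParallel_iff_forall_eq_zero`,
sorry-free) that a "wild" ring hom whose restriction to `ℚ_p` is not the structure map always exists (transport complex conjugation along an
abstract `ℚ̄_p ≃ ℂ`) and has `D_τ = ⊥`, `HT_τ = 0`, so the ring-hom form of "parallel" forces every labelled multiset to be EMPTY — the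
rev-1/2 parallel stub was vacuous and the two "non-parallel" stubs carried the whole crux.  Same fix in all three case stubs and in the
composition's `by_cases`.  (The ideator's `HasParallelLabelledWeightsAt` of Sketch.lean has the same flaw.)

**Rev 2 (after wave 1).** The lead's stub `stub_parallel` is SPLIT at the seam every Π-based proof uses: the OPEN CORE
`stub_occupancy` (K0: a continuous ℚ̄_p-POINT of the all-degree big Hecke algebra with irreducible crystalline ρ has a
characteristic-0 Hecke EIGENVECTOR in Emerton's completed cohomology of the X_U-tower — typed over `TameLevel.completedCohomology`,
`TameLevel.completedHeckeT`, `IsAssociatedFamily`; open at Eisenstein 𝔪, see NOTES-ideator1-r1.md §1 and CYCLE-c1.md) and the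
PORT `stub_parallel_of_occupancy` (Jiang Thm 1.1.1 from the eigenvector, modulo the X_U → Sh_U degree bookkeeping).  The two
non-parallel stubs are kept byte-identical to rev 1b (wave 1: `stub-blocked` on the open conjecture `FontaineMazurLanglandsGLn`).

**Reshape w.r.t. the Sketch (rev 1).**
* `stub_parallel` is typed in the shape of Jiang's Thm 1.1.1: hypothesis (2) ABSOLUTE irreducibility
  (`FramedRep.IsAbsolutelyIrreducible`) instead of irreducibility over `ℚ̄_p`; the bridge is the glue stub
  `stub_absolutelyIrreducible_of_odd` (odd + irreducible ⇒ absolutely irreducible, Darmon–Diamond–Taylor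
  Thm 3.1: in the tree as `FramedGaloisRep.IsOdd.isAbsolutelyIrreducible`, needs a real embedding of `F` and
  `(2 : ℚ̄_p) ≠ 0` — provable, worker-sized).  Hypothesis (3) is kept as CRYSTALLINE + labelled-HT-regular
  (the crux's; Jiang assumes only de Rham — stronger theorem, weaker stub) + PARALLEL.  Hypothesis (1)
  "`H̃^d(K^p, L)[χ_ρ] ≠ 0`" (completed cohomology of the Hilbert modular VARIETY in middle degree) is
  rendered by the crux's `∃ 𝒰, 𝒰.IsPadicallyAutomorphic ρ` (a continuous `ℚ̄_p`-point of the tree's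
  ALL-DEGREE big Hecke algebra of Scholze's quotients `X_U` of `GL₂/F`, torsion coefficients): this is
  WEAKER than Jiang's (1) — the gap (all-degree `X_U`-point with irreducible `ρ` ⇒ characteristic-0
  eigenvector in degree `d` of the Shimura variety) is NOT in print (needs vanishing / Eisenstein-ness of
  `H̃^{≠ d}` of Hilbert modular varieties; below middle degree announced as Pan 2026 "coming soon" in
  Jiang's bibliography) and the identification `H̃^•(X_U-tower) = H̃^•(Sh-tower)` holds only granted
  Leopoldt for `(F, p)` (the `T^{d-1}` unit-torus fibres of `X_U → Sh_U` complete away exactly when the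
  congruence-unit filtration is `p`-adically cofinal).  So `stub_parallel` = Jiang's theorem + that glue;
  it is held by the lead.
* The non-parallel case is cut by parity as in the Sketch but carries `¬ parallel` explicitly (sharper: the
  parallel sub-case of odd degree is NOT asked twice).  Both are the crux's OPEN content (Jiang Rem. 1.1.3;
  Pan II / Qiu–Su are `d = 1` / single-label) — delegated so that their status is established by attempt.

**Disproof used (rev 4):** `Cruxes/CrystallineProModularClassical/Disproof.lean` gen 1 cycle 1 (cdisprove, 05:21–05:32Z; landed
`Theorems/CrystallineProModularClassical/Negative/LoadBearing.lean`, p143378): §0 `crux_of_langlands` — the crux is a corollary of the summit, so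
no `_false_without_H` theorem exists for any hypothesis; §1g/§1h irreducibility and crystallinity are load-bearing for TRUTH (both kept in every
stub); §1d' labelled-HT-regularity AS TYPED is vacuous off the Hodge–Tate locus (content only together with the crystalline conjunct — consistent
with the rev-3 label repair: both clauses now quantify `τ : F_v →ₐ[ℚ_p] ℚ̄_p`); §5 item 7 independently flags the "point ⇒ `H̃^d[χ] ≠ 0`" glue =
`stub_occupancy`.  No `-- Targets` theorem addresses a registered stub (none is claimed false).
-/

namespace Summit.Langlands.Langlands.Cruxes.CrystallineProModularClassical.Sketch

set_option linter.dupNamespace false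
set_option linter.unusedVariables false

open Summit.Langlands.Langlands.Theses.EisensteinGelfandKirillov
open Literature.NumberTheory.Automorphic Literature.NumberTheory.GaloisRepresentations
open Literature.NumberTheory.Automorphic.BigHeckeGLn Literature.NumberTheory.PAdicHodge
open NumberField IsDedekindDomain Filter
open scoped Classical

noncomputable section

/-! ## 1. The registered stubs (the ONLY `sorry`s of the file; each a closed one-line statement). -/

/-- **Glue stub (worker) — LANDED p143332: odd irreducible two-dimensional `p`-adic representations of a totally real field are
absolutely irreducible.**  In the tree: `FramedGaloisRep.IsOdd.isAbsolutelyIrreducible (φ : K →+* ℝ)`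
(Darmon–Diamond–Taylor 1995 Thm 3.1) — supply a real embedding of the totally real `F` and `(2 : ℚ̄_p) ≠ 0`,
and bridge `ρ.toGaloisRep.IsIrreducible` to `FramedRep.IsIrreducible ρ`. -/
theorem stub_absolutelyIrreducible_of_odd : ∀ (F : Type) [Field F] [NumberField F], NumberField.IsTotallyReal F → ∀ (p : ℕ) [Fact p.Prime] (ρ : Literature.NumberTheory.GaloisRepresentations.FramedGaloisRep F (PadicAlgCl p) 2), ρ.toGaloisRep.IsIrreducible → ρ.IsOdd → Literature.NumberTheory.GaloisRepresentations.FramedRep.IsAbsolutelyIrreducible ρ :=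
  -- LANDED (wave 1, p143332, commit 3b87704796e2): `Theorems/EisensteinGelfandKirillovCrystallineProModularClassicalAbsolutelyIrreducibleOfOdd.lean`
  fun F _ _ hF p _ ρ hirr hodd =>
    Summit.Langlands.Langlands.Theorems.CrystallineProModularClassical.stub_absolutelyIrreducible_of_odd F hF p ρ hirr hodd

/-- **Stub (lead): the PARALLEL-weight case, in the shape of Jiang, arXiv:2605.18426 Thm 1.1.1** (F totally
real, any `p`; (1) pro-modular — HERE the tree's all-degree `IsPadicallyAutomorphic`, WEAKER than Jiang's
`H̃^d(K^p,L)[χ] ≠ 0`, see the module docstring; (2) absolutely irreducible; (3) crystalline (Jiang: de Rham)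
with distinct labelled Hodge–Tate weights, the same multiset `S` at every `v ∣ p` and every label) ⟹ modular
(L-algebraic cuspidal `π` on `GL₂(𝔸_F)`, Satake–Frobenius matching at almost all places).  The crux's
`5 ≤ p`, `p ∤ disc F`, `IsOdd`, a.e.-unramified binders are kept (they make the stub weaker, and `p ≥ 5`,
`p ∤ disc F` give `p`-torsion-freeness of the arithmetic subgroups of `GL₂(F)`, which the occurrence glue uses). -/
theorem stub_parallel_of_occupancy : ∀ (F : Type) [Field F] [NumberField F], NumberField.IsTotallyReal F → ∀ (p : ℕ) [Fact p.Prime], 5 ≤ p → ¬ ((p : ℤ) ∣ NumberField.discr F) → ∀ (hcpt : Literature.NumberTheory.Automorphic.isCompact_glFiniteIntegralLevel 2 F) (ι : PadicAlgCl p ≃+* ℂ) (ρ : Literature.NumberTheory.GaloisRepresentations.FramedGaloisRep F (PadicAlgCl p) 2), Literature.NumberTheory.GaloisRepresentations.FramedRep.IsAbsolutelyIrreducible ρ → ρ.IsOdd → (∀ᶠ v in cofinite, ρ.IsUnramifiedAt v) → (∃ 𝒰 : Literature.NumberTheory.Automorphic.BigHeckeGLn.TameLevel 2 F p, 𝒰.IsPadicallyAutomorphic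 ρ) → (∃ (𝒰 : Literature.NumberTheory.Automorphic.BigHeckeGLn.TameLevel 2 F p) (E : IntermediateField ℚ_[p] (PadicAlgCl p)) (_ : FiniteDimensional ℚ_[p] E) (j : ℕ) (a : IsDedekindDomain.HeightOneSpectrum (NumberField.RingOfIntegers F) → ℕ → ↥(E.toSubalgebra.toSubring ⊓ ((Valued.v : Valuation (PadicAlgCl p) NNReal).valuationSubring).toSubring)) (c : ↥(𝒰.completedCohomology ↥(E.toSubalgebra.toSubring ⊓ ((Valued.v : Valuation (PadicAlgCl p) NNReal).valuationSubring).toSubring) j)), (∀ m : ℕ, ((p : ↥(E.toSubalgebra.toSubring ⊓ ((Valued.v : Valuation (PadicAlgCl p) NNReal).valuationSubring).toSubring)) ^ m) • c ≠ 0) ∧ (∀ (w : IsDedekindDomain.HeightOneSpectrum (NumberField.RingOfIntegers F)) (hw : w ∉ 𝒰.bad) (i : ℕ), ∃ N : ℕ, (((p : ↥(E.toSubalgebra.toSubring ⊓ ((Valued.v : Valuation (PadicAlgCl p) NNReal).valuationSubring).toSubring)) ^ N) • (𝒰.completedHeckeT ↥(E.toSubalgebra.toSubring ⊓ ((Valued.v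 : Valuation (PadicAlgCl p) NNReal).valuationSubring).toSubring) hw i j c - a w i • c) = 0)) ∧ Literature.NumberTheory.Automorphic.BigHeckeGLn.IsAssociatedFamily 2 𝒰.bad (fun w i => ((a w i : ↥(E.toSubalgebra.toSubring ⊓ ((Valued.v : Valuation (PadicAlgCl p) NNReal).valuationSubring).toSubring)) : PadicAlgCl p)) ρ) → (∀ (v : IsDedekindDomain.HeightOneSpectrum (NumberField.RingOfIntegers F)) (hv : ((p : ℕ) : NumberField.RingOfIntegers F) ∈ v.asIdeal), (Literature.NumberTheory.PAdicHodge.fontainePstAdicCompletion v p hv).IsCrystallineFramed (ρ.toLocal v) ∧ (∀ τ : @AlgHom ℚ_[p] (v.adicCompletion F) (PadicAlgCl p) _ _ _ (Literature.NumberTheory.PAdicHodge.fontainePstAdicCompletion v p hv).algebra _, (ρ.labelledHodgeTateWeightsAt v (Literature.NumberTheory.PAdicHodge.fontainePstAdicCompletion v p hv).algebra (Literature.NumberTheory.PAdicHodge.fontainePstAdicCompletion v p hv).𝔅 (@AlgHom.toRingHom ℚ_[p] (v.adicCompletion F) (PadicAlgCl p) _ _ _ (Literature.NumberTheory.PAdicHodge.fontainePstAdicCompletion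 v p hv).algebra _ τ)).Nodup)) → (∃ S : Multiset ℤ, ∀ (v : IsDedekindDomain.HeightOneSpectrum (NumberField.RingOfIntegers F)) (hv : ((p : ℕ) : NumberField.RingOfIntegers F) ∈ v.asIdeal) (τ : @AlgHom ℚ_[p] (v.adicCompletion F) (PadicAlgCl p) _ _ _ (Literature.NumberTheory.PAdicHodge.fontainePstAdicCompletion v p hv).algebra _), ρ.labelledHodgeTateWeightsAt v (Literature.NumberTheory.PAdicHodge.fontainePstAdicCompletion v p hv).algebra (Literature.NumberTheory.PAdicHodge.fontainePstAdicCompletion v p hv).𝔅 (@AlgHom.toRingHom ℚ_[p] (v.adicCompletion F) (PadicAlgCl p) _ _ _ (Literature.NumberTheory.PAdicHodge.fontainePstAdicCompletion v p hv).algebra _ τ) = S) → ∃ π : Literature.NumberTheory.Automorphic.CuspidalAutomorphicRepData 2 F hcpt, π.1.IsLAlgebraic ∧ ∀ᶠ v in cofinite, Summit.Langlands.SatakeFrobCompatibleAt ι π.1 ρ v := by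
  sorry

/-- **Stub (worker): the NON-PARALLEL case in ODD degree `d = [F:ℚ]`** (conjugate-curve ladder on the Shimura
curves `X_τ` of the quaternion algebras ramified exactly at the real places `≠ τ`, unramified at all finite
places since `d - 1` is even; card `Ideas/conjugate-curve-ladder.md`).  The crux's hypotheses verbatim,
plus `Odd d` and NOT parallel.  Open in print (Jiang Rem. 1.1.3; Qiu–Su 2505.10290 is single-label). -/
theorem stub_oddDegree_nonParallel : ∀ (F : Type) [Field F] [NumberField F], NumberField.IsTotallyReal F → Odd (Module.finrank ℚ F) → ∀ (p : ℕ) [Fact p.Prime], 5 ≤ p → ¬ ((p : ℤ) ∣ NumberField.discr F) → ∀ (hcpt : Literature.NumberTheory.Automorphic.isCompact_glFiniteIntegralLevel 2 F) (ι : PadicAlgCl p ≃+* ℂ) (ρ : Literature.NumberTheory.GaloisRepresentations.FramedGaloisRep F (PadicAlgCl p) 2), ρ.toGaloisRep.IsIrreducible → ρ.IsOdd → (∀ᶠ v in cofinite, ρ.IsUnramifiedAt v) → (∃ 𝒰 : Literature.NumberTheory.Automorphic.BigHeckeGLn.TameLevel 2 F p, 𝒰.IsPadicallyAutomorphic ρ)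 → (∀ (v : IsDedekindDomain.HeightOneSpectrum (NumberField.RingOfIntegers F)) (hv : ((p : ℕ) : NumberField.RingOfIntegers F) ∈ v.asIdeal), (Literature.NumberTheory.PAdicHodge.fontainePstAdicCompletion v p hv).IsCrystallineFramed (ρ.toLocal v) ∧ (∀ τ : @AlgHom ℚ_[p] (v.adicCompletion F) (PadicAlgCl p) _ _ _ (Literature.NumberTheory.PAdicHodge.fontainePstAdicCompletion v p hv).algebra _, (ρ.labelledHodgeTateWeightsAt v (Literature.NumberTheory.PAdicHodge.fontainePstAdicCompletion v p hv).algebra (Literature.NumberTheory.PAdicHodge.fontainePstAdicCompletion v p hv).𝔅 (@AlgHom.toRingHom ℚ_[p] (v.adicCompletion F) (PadicAlgCl p) _ _ _ (Literature.NumberTheory.PAdicHodge.fontainePstAdicCompletion v p hv).algebra _ τ)).Nodup)) → (¬ ∃ S : Multiset ℤ, ∀ (v : IsDedekindDomain.HeightOneSpectrum (NumberField.RingOfIntegers F)) (hv : ((p : ℕ) : NumberField.RingOfIntegers F) ∈ v.asIdeal) (τ : @AlgHom ℚ_[p] (v.adicCompletion F) (PadicAlgCl p) _ _ _ (Literature.NumberTheory.PAdicHodge.fontainePstAdicCompletion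 v p hv).algebra _), ρ.labelledHodgeTateWeightsAt v (Literature.NumberTheory.PAdicHodge.fontainePstAdicCompletion v p hv).algebra (Literature.NumberTheory.PAdicHodge.fontainePstAdicCompletion v p hv).𝔅 (@AlgHom.toRingHom ℚ_[p] (v.adicCompletion F) (PadicAlgCl p) _ _ _ (Literature.NumberTheory.PAdicHodge.fontainePstAdicCompletion v p hv).algebra _ τ) = S) → ∃ π : Literature.NumberTheory.Automorphic.CuspidalAutomorphicRepData 2 F hcpt, π.1.IsLAlgebraic ∧ ∀ᶠ v in cofinite, Summit.Langlands.SatakeFrobCompatibleAt ι π.1 ρ v := by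
  sorry

/-- **Stub (worker): the NON-PARALLEL case in EVEN degree `d = [F:ℚ]`** (the route's flagship: real quadratic
`F`, `p` inert; quaternionic Shimura SURFACES `X_{τ,τ′}`, one direction geometric per rung — for `d = 2` the
Hilbert modular surface itself; card `Ideas/conjugate-curve-ladder.md` point 5).  The crux's hypotheses
verbatim, plus `Even d` and NOT parallel.  Open in print. -/
theorem stub_evenDegree_nonParallel : ∀ (F : Type) [Field F] [NumberField F], NumberField.IsTotallyReal F → Even (Module.finrank ℚ F) → ∀ (p : ℕ) [Fact p.Prime], 5 ≤ p → ¬ ((p : ℤ) ∣ NumberField.discr F) → ∀ (hcpt : Literature.NumberTheory.Automorphic.isCompact_glFiniteIntegralLevel 2 F) (ι : PadicAlgCl p ≃+* ℂ) (ρ : Literature.NumberTheory.GaloisRepresentations.FramedGaloisRep F (PadicAlgCl p) 2), ρ.toGaloisRep.IsIrreducible → ρ.IsOdd → (∀ᶠ v in cofinite, ρ.IsUnramifiedAt v) → (∃ 𝒰 : Literature.NumberTheory.Automorphic.BigHeckeGLn.TameLevel 2 F p, 𝒰.IsPadicallyAutomorphic ρ) → (∀ (v : IsDedekindDomain.HeightOneSpectrum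 (NumberField.RingOfIntegers F)) (hv : ((p : ℕ) : NumberField.RingOfIntegers F) ∈ v.asIdeal), (Literature.NumberTheory.PAdicHodge.fontainePstAdicCompletion v p hv).IsCrystallineFramed (ρ.toLocal v) ∧ (∀ τ : @AlgHom ℚ_[p] (v.adicCompletion F) (PadicAlgCl p) _ _ _ (Literature.NumberTheory.PAdicHodge.fontainePstAdicCompletion v p hv).algebra _, (ρ.labelledHodgeTateWeightsAt v (Literature.NumberTheory.PAdicHodge.fontainePstAdicCompletion v p hv).algebra (Literature.NumberTheory.PAdicHodge.fontainePstAdicCompletion v p hv).𝔅 (@AlgHom.toRingHom ℚ_[p] (v.adicCompletion F) (PadicAlgCl p) _ _ _ (Literature.NumberTheory.PAdicHodge.fontainePstAdicCompletion v p hv).algebra _ τ)).Nodup)) → (¬ ∃ S : Multiset ℤ, ∀ (v : IsDedekindDomain.HeightOneSpectrum (NumberField.RingOfIntegers F)) (hv : ((p : ℕ) : NumberField.RingOfIntegers F) ∈ v.asIdeal) (τ : @AlgHom ℚ_[p] (v.adicCompletion F) (PadicAlgCl p) _ _ _ (Literature.NumberTheory.PAdicHodge.fontainePstAdicCompletion v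 p hv).algebra _), ρ.labelledHodgeTateWeightsAt v (Literature.NumberTheory.PAdicHodge.fontainePstAdicCompletion v p hv).algebra (Literature.NumberTheory.PAdicHodge.fontainePstAdicCompletion v p hv).𝔅 (@AlgHom.toRingHom ℚ_[p] (v.adicCompletion F) (PadicAlgCl p) _ _ _ (Literature.NumberTheory.PAdicHodge.fontainePstAdicCompletion v p hv).algebra _ τ) = S) → ∃ π : Literature.NumberTheory.Automorphic.CuspidalAutomorphicRepData 2 F hcpt, π.1.IsLAlgebraic ∧ ∀ᶠ v in cofinite, Summit.Langlands.SatakeFrobCompatibleAt ι π.1 ρ v := by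
  sorry

/-- **Stub (lead; OPEN CORE K0 — OCCUPANCY): a pro-modular POINT has an EIGENVECTOR.**  Under the crux's hypotheses
(F totally real, `p ≥ 5`, `p ∤ disc F`; `ρ` irreducible, totally odd, a.e. unramified, a continuous `ℚ̄_p`-point of the
all-degree big Hecke algebra `𝕋(K^p)` of some tame level, crystalline HT-regular above `p`), the Hecke eigensystem of `ρ`
occurs as a CHARACTERISTIC-0 EIGENVECTOR in Emerton's completed cohomology of the `X_U`-tower of `GL₂/F`: for some tame level
`𝒰`, some finite `E/ℚ_p` inside `ℚ̄_p` with ring of integers `O = E ∩ 𝒪_{ℚ̄_p}`, some degree `j`, there is a non-torsion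
`c ∈ H̃^j(K^p)_O` (`TameLevel.completedCohomology`) with `T_{w,i} c = a_{w,i} c` for all good `w ∉ S` and all `i`
(`TameLevel.completedHeckeT`), the eigenvalues being associated with `ρ` (`IsAssociatedFamily`: `charpoly ρ(Frob_w) =
X² − a_{w,1}X + q_w a_{w,2}`).  This is hypothesis (1) of Pan II / Qiu–Su / Jiang ("`H̃[𝔭_ρ] ≠ 0`") up to the degree/torus
bookkeeping `X_U → Sh_U`; "point ⇒ eigenvector" is NOT formal (NOTES-ideator1-r1.md §1: interstitial mod-`p^s` eigensystems;
in print only via p-adic local Langlands for `GL₂(ℚ_p)` (Emerton) or miracle flatness at NON-Eisenstein 𝔪 (Gee–Newton +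
BHHMS)) and is OPEN at Eisenstein 𝔪 — the route's home.  Shared by every line of this crux. -/
theorem stub_occupancy : ∀ (F : Type) [Field F] [NumberField F], NumberField.IsTotallyReal F → ∀ (p : ℕ) [Fact p.Prime], 5 ≤ p → ¬ ((p : ℤ) ∣ NumberField.discr F) → ∀ (ρ : Literature.NumberTheory.GaloisRepresentations.FramedGaloisRep F (PadicAlgCl p) 2), ρ.toGaloisRep.IsIrreducible → ρ.IsOdd → (∀ᶠ v in cofinite, ρ.IsUnramifiedAt v) → (∃ 𝒰 : Literature.NumberTheory.Automorphic.BigHeckeGLn.TameLevel 2 F p, 𝒰.IsPadicallyAutomorphic ρ) → (∀ (v : IsDedekindDomain.HeightOneSpectrum (NumberField.RingOfIntegers F)) (hv : ((p : ℕ) : NumberField.RingOfIntegers F) ∈ v.asIdeal), (Literature.NumberTheory.PAdicHodge.fontainePstAdicCompletion v p hv).IsCrystallineFramed (ρ.toLocal v) ∧ (∀ τ : @AlgHom ℚ_[p] (v.adicCompletion F) (PadicAlgCl p) _ _ _ (Literature.NumberTheory.PAdicHodge.fontainePstAdicCompletion v p hv).algebra _, (ρ.labelledHodgeTateWeightsAt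 v (Literature.NumberTheory.PAdicHodge.fontainePstAdicCompletion v p hv).algebra (Literature.NumberTheory.PAdicHodge.fontainePstAdicCompletion v p hv).𝔅 (@AlgHom.toRingHom ℚ_[p] (v.adicCompletion F) (PadicAlgCl p) _ _ _ (Literature.NumberTheory.PAdicHodge.fontainePstAdicCompletion v p hv).algebra _ τ)).Nodup)) → (∃ (𝒰 : Literature.NumberTheory.Automorphic.BigHeckeGLn.TameLevel 2 F p) (E : IntermediateField ℚ_[p] (PadicAlgCl p)) (_ : FiniteDimensional ℚ_[p] E) (j : ℕ) (a : IsDedekindDomain.HeightOneSpectrum (NumberField.RingOfIntegers F) → ℕ → ↥(E.toSubalgebra.toSubring ⊓ ((Valued.v : Valuation (PadicAlgCl p) NNReal).valuationSubring).toSubring)) (c : ↥(𝒰.completedCohomology ↥(E.toSubalgebra.toSubring ⊓ ((Valued.v : Valuation (PadicAlgCl p) NNReal).valuationSubring).toSubring) j)), (∀ m : ℕ, ((p : ↥(E.toSubalgebra.toSubring ⊓ ((Valued.v : Valuation (PadicAlgCl p) NNReal).valuationSubring).toSubring)) ^ m) • c ≠ 0) ∧ (∀ (w : IsDedekindDomain.HeightOneSpectrum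 (NumberField.RingOfIntegers F)) (hw : w ∉ 𝒰.bad) (i : ℕ), ∃ N : ℕ, (((p : ↥(E.toSubalgebra.toSubring ⊓ ((Valued.v : Valuation (PadicAlgCl p) NNReal).valuationSubring).toSubring)) ^ N) • (𝒰.completedHeckeT ↥(E.toSubalgebra.toSubring ⊓ ((Valued.v : Valuation (PadicAlgCl p) NNReal).valuationSubring).toSubring) hw i j c - a w i • c) = 0)) ∧ Literature.NumberTheory.Automorphic.BigHeckeGLn.IsAssociatedFamily 2 𝒰.bad (fun w i => ((a w i : ↥(E.toSubalgebra.toSubring ⊓ ((Valued.v : Valuation (PadicAlgCl p) NNReal).valuationSubring).toSubring)) : PadicAlgCl p)) ρ) := by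
  sorry

/-! ## 2. The composition (pure logic; no `sorry` below this line). -/

/-- **The line closes the crux modulo its stubs**: case split on parallelness of the labelled Hodge–Tate weights
(`Classical.em`) and on the parity of `[F:ℚ]` (`Nat.even_or_odd`); in the parallel case irreducibility is
upgraded to absolute irreducibility by `stub_absolutelyIrreducible_of_odd`.  Concludes
`Summit.Langlands.Langlands.Theses.EisensteinGelfandKirillov.CrystallineProModularClassical` BY NAME. -/
theorem CrystallineProModularClassical_of : CrystallineProModularClassical := by
  intro F _ _ hF p _ hp hdisc hcpt ι ρ hirr hodd hur hpm hloc
  -- the crux's local hypothesis at `v ∣ p`, with `IsLabelledHodgeTateRegular` unfolded to the `:=`-free form of the stubs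
  have hloc' : ∀ (v : IsDedekindDomain.HeightOneSpectrum (NumberField.RingOfIntegers F)) (hv : ((p : ℕ) : NumberField.RingOfIntegers F) ∈ v.asIdeal), (Literature.NumberTheory.PAdicHodge.fontainePstAdicCompletion v p hv).IsCrystallineFramed (ρ.toLocal v) ∧ (∀ τ : @AlgHom ℚ_[p] (v.adicCompletion F) (PadicAlgCl p) _ _ _ (Literature.NumberTheory.PAdicHodge.fontainePstAdicCompletion v p hv).algebra _, (ρ.labelledHodgeTateWeightsAt v (Literature.NumberTheory.PAdicHodge.fontainePstAdicCompletion v p hv).algebra (Literature.NumberTheory.PAdicHodge.fontainePstAdicCompletion v p hv).𝔅 (@AlgHom.toRingHom ℚ_[p] (v.adicCompletion F) (PadicAlgCl p) _ _ _ (Literature.NumberTheory.PAdicHodge.fontainePstAdicCompletion v p hv).algebra _ τ)).Nodup) :=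
    fun v hv => ⟨(hloc v hv).1, fun τ => (hloc v hv).2 τ⟩
  by_cases hpar : ∃ S : Multiset ℤ, ∀ (v : IsDedekindDomain.HeightOneSpectrum (NumberField.RingOfIntegers F)) (hv : ((p : ℕ) : NumberField.RingOfIntegers F) ∈ v.asIdeal) (τ : @AlgHom ℚ_[p] (v.adicCompletion F) (PadicAlgCl p) _ _ _ (Literature.NumberTheory.PAdicHodge.fontainePstAdicCompletion v p hv).algebra _), ρ.labelledHodgeTateWeightsAt v (Literature.NumberTheory.PAdicHodge.fontainePstAdicCompletion v p hv).algebra (Literature.NumberTheory.PAdicHodge.fontainePstAdicCompletion v p hv).𝔅 (@AlgHom.toRingHom ℚ_[p] (v.adicCompletion F) (PadicAlgCl p) _ _ _ (Literature.NumberTheory.PAdicHodge.fontainePstAdicCompletion v p hv).algebra _ τ) = S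
  · have hocc := stub_occupancy F hF p hp hdisc ρ hirr hodd hur hpm hloc'
    exact stub_parallel_of_occupancy F hF p hp hdisc hcpt ι ρ (stub_absolutelyIrreducible_of_odd F hF p ρ hirr hodd) hodd hur hpm hocc hloc' hpar
  · rcases Nat.even_or_odd (Module.finrank ℚ F) with hev | hod
    · exact stub_evenDegree_nonParallel F hF hev p hp hdisc hcpt ι ρ hirr hodd hur hpm hloc' hpar
    · exact stub_oddDegree_nonParallel F hF hod p hp hdisc hcpt ι ρ hirr hodd hur hpm hloc' hpar

end

end Summit.Langlands.Langlands.Cruxes.CrystallineProModularClassical.Sketch
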